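import Summits.PneNP.PneNP.Theorems.NegLimitedAmplifiedWindowCriticalWindow
import Summits.PneNP.PneNP.Theorems.NegLimitedAmplifiedWindowMonotoneAmplification
import Summits.PneNP.PneNP.Theorems.NegLimitedAmplifiedWindowEngineAssembly
import Summits.PneNP.PneNP.Theorems.NegLimitedAmplifiedWindowSlicesNP
import Summits.PneNP.PneNP.Theorems.NegLimitedAmplifiedWindowDoorAssembly
import Mathlib
import HarnessLib

/-!
# Route NegLimited — the door item `NeglimitedEpsLogNegationsR` via the line `amplified-window` (rung F-N1/p3)

The CLOSER of pnp-ideate-p3's registered skeleton `amplified-window` (HOME/pnp-ideate-p3/r11/amplified-window.lean,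
v2 sha c828757ca2bc7a67; card r11/amplified-window.md; ROUND-11/12) on the door item stmt-PneNP-19860
`Summit.PneNP.PneNP.Theses.NegLimited.NeglimitedEpsLogNegationsR`: ONE explicit `NP` language with monotone
slices whose slices infinitely often need more than `n^k` De Morgan gates under a NOT budget `⌊ε·log₂ n⌋`
(for every `k`, one fixed `ε > 0`).

The composition is p3's `NeglimitedEpsLogNegationsR_of` VERBATIM (kernel-checked modus ponens of the six
statements of `NegLimitedAmplifiedWindowDefs.lean`), fed with the landed stubs BY NAME:
* (T) `transfer_holds` — correlation/negations transfer (Defs, from `NegLimitedDoor.one_le_negations_mul_corr`);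
* (B) `stub_criticalWindow` (p472908) — constant-error average-case hardness of fixed-`k` CLIQUE against
  polynomial-size MONOTONE circuits under a balanced critical-window ladder mixture (from the tree's
  `thm1_sparse_relative`, Rossman 2010);
* (A) `stub_monotoneAmplification` (p485087) — Impagliazzo hard-core + O'Donnell recursive-majority hybrid,
  monotone version (parts `Amp.*`, p479928–p484409);
* (EA) `stub_engineAssembly` (p466977), (S) `stub_slicesNP` (p479124), (DA) `stub_doorAssembly` (p467364).

References: A. A. Markov (1958) / M. J. Fischer (1975) (negation-limited circuits); K. Amano, A. Maruoka,
SIAM J. Comput. 35 (2005) [AmanoMaruoka2005]; B. Rossman, *The monotone complexity of k-clique on random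
graphs*, FOCS 2010 / SICOMP 43 (2014) [Rossman2010]; B. Rossman, *Correlation bounds against monotone NC¹*,
CCC 2015 [Rossman2015]; R. Impagliazzo, FOCS 1995; R. O'Donnell, JCSS 69 (2004).

HONEST FRAMING: this closes ONE crux item of ONE route (NegLimited) on the FRONTIER rung F-N1 — a
negation-limited (`ε·log n` NOT gates) superpolynomial lower bound for an explicit monotone-slice `NP`
language, assembled from Rossman's average-case monotone clique bound and monotone hardness amplification.
It says NOTHING about unrestricted circuits; nothing here bears on P vs NP beyond the rung's bookkeeping.
Any wording of this as new relative to print is the planner's/referee's call (ROUND-12 print sweep), not this file's.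
-/

set_option linter.dupNamespace false -- `Summit.PneNP.PneNP.…`: summit = sub-problem name (D-0017 single-conjunct layout)

namespace Summit.PneNP.PneNP.Theorems.NegLimitedAmplifiedWindow

/-- The crux from the six stub statements (p3's kernel-checked composition, verbatim). -/
theorem NeglimitedEpsLogNegationsR_of :
    CriticalWindowHardness → MonotoneAmplification → EngineAssembly → CorrelationNegationsTransfer →
      AmplifiedCliqueSlicesNP → DoorAssembly →
      Summit.PneNP.PneNP.Theses.NegLimited.NeglimitedEpsLogNegationsR :=
  fun hB hA hEA hT hS hDA => hDA hT hS (hEA hB hA)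

/-- The engine's output (E) from its three stubs: `(½ + ℓ^{−ε})`-hardness of `RM3 ⊗ CLIQUE` for all
polynomial-size monotone circuits. -/
theorem amplifiedCliqueCorrelation_of_stubs : AmplifiedCliqueCorrelation :=
  stub_engineAssembly stub_criticalWindow stub_monotoneAmplification

/-- **The door item BY NAME** (stmt-PneNP-19860), from the five landed stubs and the proved transfer (T). -/
theorem neglimitedEpsLogNegationsR_via_amplifiedWindow :
    Summit.PneNP.PneNP.Theses.NegLimited.NeglimitedEpsLogNegationsR :=
  NeglimitedEpsLogNegationsR_of stub_criticalWindow stub_monotoneAmplification stub_engineAssembly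
    transfer_holds stub_slicesNP stub_doorAssembly

end Summit.PneNP.PneNP.Theorems.NegLimitedAmplifiedWindow
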